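import Summits.FinalStateConjecture.FinalStateConjecture.Theorems.EIHFluxBalanceInertialRecessionVirialTelescope
import Summits.FinalStateConjecture.FinalStateConjecture.Theorems.EIHFluxBalanceInertialRecessionVirialIdentity
import Summits.FinalStateConjecture.FinalStateConjecture.Theorems.EIHFluxBalanceInertialRecessionVirialAbel

/-!
# Route EIHFluxBalance — crux `InertialRecession`, abstract endgame for general `N`:
# assembling the virial sum — the discrete identity over a family per step; Abel on a fiber; one set's alive steps

Helper file for the crux `stmt-FinalStateConjecture-10166` (virial route; `InertialRecession_seat0_session8_note.md` §A).
Mathlib-only bookkeeping, indexed by STEP NUMBER `i` (time `tᵢ = T + i h`):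

* `virial_sum_identity` — for momenta `p j i`, positions `ξ j i`, rest-mass centres and ANY families `F i` of strict subsets of the
  root `𝒦` with parent maps `par i` (parent properties) containing the singletons:
  `G n − G 0 = Σ_{i<n} Σⱼ ⟨pⱼ(i), Δᵢξⱼ − ΔᵢX⟩ + Σ_{B ⊆ 𝒦} Σ_{i<n, B ∈ F i} ⟨ΔᵢΠ_B, X_B(i+1) − X_{par B}(i+1)⟩`
  (`virial_step_identity` + the lever identity `sum_inner_lever_eq_sum_nodes'`, then swapping the sums);
* `abs_sum_Ico_inner_sub_le` — Abel summation on an index interval `[s, e)` (reindexing of `abs_sum_inner_sub_le_fuzz'`);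
* `abs_sum_alive_le` — if the alive steps of one set come in KEYED blocks (the key is constant on its index block) and each full block
  is bounded by the sum of nonnegative weights over it while a block cut by `n` is bounded by `J`, then the whole alive sum is bounded
  by `Σ_alive w + J` (at most one block is cut).
-/

noncomputable section

open Finset

namespace Summit.FinalStateConjecture.FinalStateConjecture.Theorems.SublinearIsFree.Virial

open Literature.Geometry.Lorentzian

variable {ι : Type*} [DecidableEq ι]

/-! ### The discrete virial identity over families -/

/-- **Virial sum identity.** See the module docstring. [folklore] -/
theorem virial_sum_identity (𝒦 : Finset ι) (M : ι → ℝ) (hM : ∀ i, 0 < M i) (p ξ : ι → ℕ → E3)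
    (F : ℕ → Finset (Finset ι)) (par : ℕ → Finset ι → Finset ι)
    (hF : ∀ i, ∀ A ∈ F i, A ⊂ 𝒦) (hp₁ : ∀ i, ∀ A ∈ F i, A ⊂ par i A)
    (hp₂ : ∀ i, ∀ A ∈ F i, par i A ∈ F i ∨ par i A = 𝒦)
    (hp₃ : ∀ i, ∀ A ∈ F i, ∀ B, (B ∈ F i ∨ B = 𝒦) → A ⊂ B → par i A ⊆ B)
    (hsing : ∀ i, ∀ j ∈ 𝒦, ({j} : Finset ι) ∈ F i) (n : ℕ) :
    (∑ j ∈ 𝒦, inner ℝ (p j n) (ξ j n - (∑ k ∈ 𝒦, M k)⁻¹ • ∑ k ∈ 𝒦, M k • ξ k n)) -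
      ∑ j ∈ 𝒦, inner ℝ (p j 0) (ξ j 0 - (∑ k ∈ 𝒦, M k)⁻¹ • ∑ k ∈ 𝒦, M k • ξ k 0) =
    (∑ i ∈ range n, ∑ j ∈ 𝒦, inner ℝ (p j i) ((ξ j (i + 1) - ξ j i) -
        ((∑ k ∈ 𝒦, M k)⁻¹ • ∑ k ∈ 𝒦, M k • ξ k (i + 1) - (∑ k ∈ 𝒦, M k)⁻¹ • ∑ k ∈ 𝒦, M k • ξ k i))) +
    ∑ B ∈ 𝒦.powerset, ∑ i ∈ (range n).filter (fun i ↦ B ∈ F i),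
      inner ℝ (∑ j ∈ B, p j (i + 1) - ∑ j ∈ B, p j i)
        ((∑ k ∈ B, M k)⁻¹ • ∑ k ∈ B, M k • ξ k (i + 1) -
          (∑ k ∈ par i B, M k)⁻¹ • ∑ k ∈ par i B, M k • ξ k (i + 1)) := by
  -- notation
  set X : ℕ → E3 := fun i ↦ (∑ k ∈ 𝒦, M k)⁻¹ • ∑ k ∈ 𝒦, M k • ξ k i with hX
  set G : ℕ → ℝ := fun i ↦ ∑ j ∈ 𝒦, inner ℝ (p j i) (ξ j i - X i) with hG
  set Y : ℕ → Finset ι → E3 := fun i A ↦ (∑ k ∈ A, M k)⁻¹ • ∑ k ∈ A, M k • ξ k i with hY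
  -- one step
  have hstep : ∀ i, G (i + 1) - G i =
      ∑ B ∈ F i, inner ℝ (∑ j ∈ B, p j (i + 1) - ∑ j ∈ B, p j i) (Y (i + 1) B - Y (i + 1) (par i B)) +
      ∑ j ∈ 𝒦, inner ℝ (p j i) ((ξ j (i + 1) - ξ j i) - (X (i + 1) - X i)) := by
    intro i
    have h1 := virial_step_identity 𝒦 (fun j ↦ p j i) (fun j ↦ p j (i + 1)) (fun j ↦ ξ j i) (fun j ↦ ξ j (i + 1))
      (X i) (X (i + 1))
    simp only [hG]
    rw [h1]
    congr 1
    -- the lever identity with `Y (i+1)`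
    have h2 := sum_inner_lever_eq_sum_nodes' (F i) 𝒦 (par i) (hF i) (hp₁ i) (hp₂ i) (hp₃ i) (hsing i)
      (fun j ↦ p j (i + 1) - p j i) (Y (i + 1))
    have hYs : ∀ j, Y (i + 1) {j} = ξ j (i + 1) := fun j ↦ by
      simp only [hY]
      rw [Finset.sum_singleton, Finset.sum_singleton, smul_smul, inv_mul_cancel₀ (hM j).ne', one_smul]
    have hYK : Y (i + 1) 𝒦 = X (i + 1) := rfl
    simp only [hYs, hYK] at h2
    rw [h2]
    refine Finset.sum_congr rfl fun B _ ↦ ?_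
    rw [Finset.sum_sub_distrib]
  -- telescope over the steps
  have htel : G n - G 0 = ∑ i ∈ range n, (G (i + 1) - G i) := (Finset.sum_range_sub G n).symm
  show G n - G 0 = _
  rw [htel, Finset.sum_congr rfl fun i _ ↦ hstep i, Finset.sum_add_distrib, add_comm]
  congr 1
  -- swap `Σ_i Σ_{B ∈ F i}` into `Σ_{B ⊆ 𝒦} Σ_{i, B ∈ F i}`
  rw [Finset.sum_comm' (t' := 𝒦.powerset) (s' := fun B ↦ (range n).filter fun i ↦ B ∈ F i)]
  intro i B
  simp only [Finset.mem_filter, Finset.mem_powerset]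
  constructor
  · rintro ⟨hi, hB⟩
    exact ⟨⟨hi, hB⟩, (hF i B hB).1⟩
  · rintro ⟨⟨hi, hB⟩, _⟩
    exact ⟨hi, hB⟩

/-! ### Abel summation on an index interval -/

omit [DecidableEq ι] in
/-- **Abel on a fiber.** If `‖f i − f s‖ ≤ ζ` for `s ≤ i ≤ e`, `‖L e‖ ≤ Lm`, and `‖L (i+1) − L i‖ ≤ λ` for `s ≤ i < e`, then
`|Σ_{i ∈ [s,e)} ⟨f(i+1) − f i, L(i+1)⟩| ≤ ζ (Lm + (e − s) λ)`. [folklore] -/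
theorem abs_sum_Ico_inner_sub_le (f L : ℕ → E3) {s e : ℕ} (hse : s ≤ e) {ζ Lm lam : ℝ}
    (hf : ∀ i, s ≤ i → i ≤ e → ‖f i - f s‖ ≤ ζ) (hLm : ‖L e‖ ≤ Lm) (hlam : ∀ i, s ≤ i → i < e → ‖L (i + 1) - L i‖ ≤ lam) :
    |∑ i ∈ Ico s e, inner ℝ (f (i + 1) - f i) (L (i + 1))| ≤ ζ * (Lm + (e - s) * lam) := by
  obtain ⟨m, rfl⟩ := Nat.exists_eq_add_of_le hse
  have hζ : 0 ≤ ζ := (norm_nonneg _).trans (hf s le_rfl (Nat.le_add_right _ _))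
  -- reindex to `range m`
  have hre : ∑ i ∈ Ico s (s + m), inner ℝ (f (i + 1) - f i) (L (i + 1)) =
      ∑ k ∈ range m, inner ℝ (f (s + (k + 1)) - f (s + k)) (L (s + (k + 1))) := by
    rw [Finset.sum_Ico_eq_sum_range, Nat.add_sub_cancel_left]
    refine Finset.sum_congr rfl fun k _ ↦ ?_
    rw [add_assoc]
  rw [hre]
  have hf' : ∀ k, k ≤ m → ‖(fun k ↦ f (s + k)) k - (fun k ↦ f (s + k)) 0‖ ≤ ζ := fun k hk ↦ by
    beta_reduce
    rw [add_zero]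
    exact hf (s + k) (Nat.le_add_right _ _) (by omega)
  have h := abs_sum_inner_sub_le_fuzz' (fun k ↦ f (s + k)) (fun k ↦ L (s + k)) m ζ hf'
  beta_reduce at h
  refine h.trans ?_
  have hsum : ∑ k ∈ range m, ‖L (s + (k + 1)) - L (s + k)‖ ≤ m * lam := by
    calc ∑ k ∈ range m, ‖L (s + (k + 1)) - L (s + k)‖ ≤ ∑ _k ∈ range m, lam :=
          Finset.sum_le_sum fun k hk ↦ by
            have := hlam (s + k) (Nat.le_add_right _ _) (by have := Finset.mem_range.mp hk; omega)
            rwa [add_assoc] at this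
      _ = m * lam := by rw [Finset.sum_const, Finset.card_range, nsmul_eq_mul]
  have hcast : ((s + m : ℕ) : ℝ) - s = m := by push_cast; ring
  rw [hcast]
  have hLm' : ‖L (s + m)‖ ≤ Lm := hLm
  nlinarith [norm_nonneg (L (s + m)), Finset.sum_nonneg (fun k (_ : k ∈ range m) ↦ norm_nonneg (L (s + (k + 1)) - L (s + k)))]

/-! ### One set's alive steps -/

omit [DecidableEq ι] in
/-- **At most one block is cut.** Let `alive ⊆ range n` and `key : ℕ → ℕ × ℕ` with the BLOCK PROPERTY: for `i ∈ alive` with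
`key i = (d, s)`, `s ≤ i < s + 2^d`, and every `i′ < n` with `s ≤ i′ < s + 2^d` is alive with the same key. If for every alive `i`
whose block ends by `n` (`s + 2^d ≤ n`) the block sum of `X` is at most the block sum of the nonnegative weights `w`, and for every
alive `i` whose block is cut (`n < s + 2^d`) the partial block sum is at most `J ≥ 0`, then `|Σ_alive X| ≤ Σ_alive w + J`. [folklore] -/
theorem abs_sum_alive_le {n : ℕ} {alive : Finset ℕ} (halive : alive ⊆ range n) (key : ℕ → ℕ × ℕ) (X w : ℕ → ℝ) {J : ℝ}
    (hJ : 0 ≤ J) (hw : ∀ i ∈ alive, 0 ≤ w i)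
    (hkey : ∀ i ∈ alive, (key i).2 ≤ i ∧ i < (key i).2 + 2 ^ (key i).1 ∧
      ∀ i', i' < n → (key i).2 ≤ i' → i' < (key i).2 + 2 ^ (key i).1 → i' ∈ alive ∧ key i' = key i)
    (hfull : ∀ i ∈ alive, (key i).2 + 2 ^ (key i).1 ≤ n →
      |∑ i' ∈ Ico (key i).2 ((key i).2 + 2 ^ (key i).1), X i'| ≤ ∑ i' ∈ Ico (key i).2 ((key i).2 + 2 ^ (key i).1), w i')
    (hpart : ∀ i ∈ alive, n < (key i).2 + 2 ^ (key i).1 → |∑ i' ∈ Ico (key i).2 n, X i'| ≤ J) :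
    |∑ i ∈ alive, X i| ≤ ∑ i ∈ alive, w i + J := by
  classical
  -- the fiber of a key is an index interval
  have hfiber : ∀ i ∈ alive, alive.filter (fun i' ↦ key i' = key i) =
      Ico (key i).2 (min ((key i).2 + 2 ^ (key i).1) n) := by
    intro i hi
    obtain ⟨h1, h2, h3⟩ := hkey i hi
    ext i'
    simp only [Finset.mem_filter, Finset.mem_Ico, lt_min_iff]
    constructor
    · rintro ⟨hi', hk⟩
      obtain ⟨h1', h2', _⟩ := hkey i' hi'
      rw [hk] at h1' h2'
      exact ⟨h1', h2', Finset.mem_range.mp (halive hi')⟩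
    · rintro ⟨hs, hlt, hn⟩
      exact h3 i' hn hs hlt
  -- decompose the alive sum over the keys
  have hdecX : ∑ i ∈ alive, X i = ∑ κ ∈ alive.image key, ∑ i ∈ alive.filter (fun i ↦ key i = κ), X i :=
    (Finset.sum_fiberwise_of_maps_to (fun i hi ↦ Finset.mem_image_of_mem key hi) X).symm
  have hdecw : ∑ i ∈ alive, w i = ∑ κ ∈ alive.image key, ∑ i ∈ alive.filter (fun i ↦ key i = κ), w i :=
    (Finset.sum_fiberwise_of_maps_to (fun i hi ↦ Finset.mem_image_of_mem key hi) w).symm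
  rw [hdecX, hdecw]
  -- split keys into full and cut
  set keys := alive.image key with hkeys
  set full := keys.filter (fun κ ↦ κ.2 + 2 ^ κ.1 ≤ n) with hfullset
  set cut := keys.filter (fun κ ↦ ¬ κ.2 + 2 ^ κ.1 ≤ n) with hcutset
  have hsplitX : ∑ κ ∈ keys, ∑ i ∈ alive.filter (fun i ↦ key i = κ), X i =
      ∑ κ ∈ full, ∑ i ∈ alive.filter (fun i ↦ key i = κ), X i + ∑ κ ∈ cut, ∑ i ∈ alive.filter (fun i ↦ key i = κ), X i :=
    (Finset.sum_filter_add_sum_filter_not keys _ _).symm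
  have hsplitw : ∑ κ ∈ full, ∑ i ∈ alive.filter (fun i ↦ key i = κ), w i ≤
      ∑ κ ∈ keys, ∑ i ∈ alive.filter (fun i ↦ key i = κ), w i :=
    Finset.sum_le_sum_of_subset_of_nonneg (Finset.filter_subset _ _) fun κ _ _ ↦
      Finset.sum_nonneg fun i hi ↦ hw i (Finset.mem_filter.mp hi).1
  -- full keys: bounded by weights
  have hfullb : ∀ κ ∈ full, |∑ i ∈ alive.filter (fun i ↦ key i = κ), X i| ≤ ∑ i ∈ alive.filter (fun i ↦ key i = κ), w i := by
    intro κ hκ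
    obtain ⟨hκk, hκn⟩ := Finset.mem_filter.mp hκ
    obtain ⟨i, hi, rfl⟩ := Finset.mem_image.mp hκk
    rw [hfiber i hi, min_eq_left hκn]
    exact hfull i hi hκn
  -- cut keys: all equal to the key of `n - 1`, so at most one
  have hcutb : |∑ κ ∈ cut, ∑ i ∈ alive.filter (fun i ↦ key i = κ), X i| ≤ J := by
    by_cases hc : cut.Nonempty
    · obtain ⟨κ₀, hκ₀⟩ := hc
      have hall : ∀ κ ∈ cut, κ = κ₀ := by
        -- both blocks contain `n - 1`
        have key_of : ∀ κ ∈ cut, ∃ i ∈ alive, key i = κ ∧ n < (key i).2 + 2 ^ (key i).1 := by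
          intro κ hκ
          obtain ⟨hκk, hκn⟩ := Finset.mem_filter.mp hκ
          obtain ⟨i, hi, rfl⟩ := Finset.mem_image.mp hκk
          exact ⟨i, hi, rfl, not_le.mp hκn⟩
        intro κ hκ
        obtain ⟨i, hi, rfl, hin⟩ := key_of κ hκ
        obtain ⟨i₀, hi₀, rfl, hin₀⟩ := key_of κ₀ hκ₀
        have hn1 : n - 1 < n := by
          have := Finset.mem_range.mp (halive hi); omega
        have h1 := (hkey i hi).2.2 (n - 1) hn1 (by have := (hkey i hi).1; have := Finset.mem_range.mp (halive hi); omega)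
          (by omega)
        have h2 := (hkey i₀ hi₀).2.2 (n - 1) hn1
          (by have := (hkey i₀ hi₀).1; have := Finset.mem_range.mp (halive hi₀); omega) (by omega)
        rw [← h1.2, ← h2.2]
      have hcut1 : cut = {κ₀} := by
        ext κ
        simp only [Finset.mem_singleton]
        exact ⟨fun h ↦ hall κ h, fun h ↦ h ▸ hκ₀⟩
      rw [hcut1, Finset.sum_singleton]
      obtain ⟨hκk, hκn⟩ := Finset.mem_filter.mp hκ₀
      obtain ⟨i, hi, rfl⟩ := Finset.mem_image.mp hκk
      rw [hfiber i hi, min_eq_right (not_le.mp hκn).le]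
      exact hpart i hi (not_le.mp hκn)
    · rw [Finset.not_nonempty_iff_eq_empty.mp hc, Finset.sum_empty, abs_zero]
      exact hJ
  rw [hsplitX]
  calc |∑ κ ∈ full, ∑ i ∈ alive.filter (fun i ↦ key i = κ), X i + ∑ κ ∈ cut, ∑ i ∈ alive.filter (fun i ↦ key i = κ), X i|
      ≤ |∑ κ ∈ full, ∑ i ∈ alive.filter (fun i ↦ key i = κ), X i| + |∑ κ ∈ cut, ∑ i ∈ alive.filter (fun i ↦ key i = κ), X i| :=
        abs_add_le _ _
    _ ≤ ∑ κ ∈ full, |∑ i ∈ alive.filter (fun i ↦ key i = κ), X i| + J := add_le_add (Finset.abs_sum_le_sum_abs _ _) hcutb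
    _ ≤ ∑ κ ∈ full, ∑ i ∈ alive.filter (fun i ↦ key i = κ), w i + J := add_le_add (Finset.sum_le_sum hfullb) le_rfl
    _ ≤ ∑ κ ∈ keys, ∑ i ∈ alive.filter (fun i ↦ key i = κ), w i + J := add_le_add hsplitw le_rfl

/-- Registered one-line form of `abs_sum_alive_le` (at most one block is cut). [folklore] -/
theorem abs_sum_alive_le_of_keyed : open Finset in ∀ {n : ℕ} {alive : Finset ℕ}, alive ⊆ range n → ∀ (key : ℕ → ℕ × ℕ) (X w : ℕ → ℝ) {J : ℝ}, 0 ≤ J → (∀ i ∈ alive, 0 ≤ w i) → (∀ i ∈ alive, (key i).2 ≤ i ∧ i < (key i).2 + 2 ^ (key i).1 ∧ ∀ i', i' < n → (key i).2 ≤ i' → i' < (key i).2 + 2 ^ (key i).1 → i' ∈ alive ∧ key i' = key i) → (∀ i ∈ alive, (key i).2 + 2 ^ (key i).1 ≤ n → |∑ i' ∈ Ico (key i).2 ((key i).2 + 2 ^ (key i).1), X i'| ≤ ∑ i' ∈ Ico (key i).2 ((key i).2 + 2 ^ (key i).1), w i') → (∀ i ∈ alive, n < (key i).2 + 2 ^ (key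 i).1 → |∑ i' ∈ Ico (key i).2 n, X i'| ≤ J) → |∑ i ∈ alive, X i| ≤ ∑ i ∈ alive, w i + J :=
  fun halive key X w _ hJ hw hkey hfull hpart ↦ abs_sum_alive_le halive key X w hJ hw hkey hfull hpart

end Summit.FinalStateConjecture.FinalStateConjecture.Theorems.SublinearIsFree.Virial

end
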